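import Literature.IUT.LogThetaLattice.GlobalLGPFrobenioidsRealifiedModel
import Literature.IUT.LogThetaLattice.GlobalRealifiedLGPFrobenioids
import Literature.AlgebraicGeometry.Frobenioids.MonoidTransport
import HarnessLib

/-!
# [IUTchIII] Proposition 3.7 (iii)/(iv) «†𝔉^⊩_lgp = (†𝒞^⊩_lgp, Prime(†𝒞^⊩_lgp) ⥲ V̲, …, {†ρ_{lgp,v}}_v)», D: the primes of
# the divisor monoid `Φ^rlf` of the CATEGORICAL realified Frobenioid `(†𝓕⊛ℝ_𝔪𝔬𝔡)_α` are the places, and the local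
# degrees `Φ^rlf → Φ^rlf_v = ℝ_{≥0}`

abc-iut cell, layer L6, wave-5 seat abc-iut-w5-d153 (gen 2); part D of the lineage RealifiedRatFn (A) /
RealifiedModel (B; imported) / RealifiedFrobenioid (C, sibling file, not imported: `Prop37.FrakRlfCat F ≌
ModelFrobenioid(𝒟, Φ^rlf, ℝ · Φ^birat)`, a FROBENIOID in [FrdI] Def. 1.3's sense, divisor monoid `PhiRlf F` = the
`EffDiv (ModelPlaces F) ℝ ℝ_{≥0}` of this file).

PRINT. [IUTchIII] Prop. 3.7 (iii) p. 110 l. 69–90: "one obtains a functorial algorithm … to construct a [global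
realified] Frobenioid `†𝒞^⊩_LGP` [and] an `𝓕^⊩`-prime-strip `†𝔉^⊩_LGP = (†𝒞^⊩_LGP, Prime(†𝒞^⊩_LGP) ⥲ V̲, †𝔉^⊢_LGP,
{†ρ_{LGP,v}}_{v∈V̲})`"; (iv) p. 111: "`†𝔉^⊩_lgp = (†𝒞^⊩_lgp, Prime(†𝒞^⊩_lgp) ⥲ V̲, †𝔉^⊢_lgp, {†ρ_{lgp,v}}_{v∈V̲})`"
[claim key Mochizuki2012, status disputed (D-0012)]; [IUTchI] Ex. 3.5 (i) p. 77 (the model: "`Prime(𝒞^⊩_mod) ⥲ V_mod`",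
"`Φ_{𝒞^⊩_mod,v}` … the `v`-component of `Φ_{𝒞^⊩_mod}`", `ρ_v : Φ_{𝒞^⊩_mod,v} ⥲ Φ^rlf_{𝒞^⊢_v}`); [FrdI] §0 p. 12
("primes" of a monoid: `≼`-classes of primary elements), Ex. 6.3 p. 113 ("`Prime(Φ(L)) ≃ V(L)`")
[cite: MochizukiFrdI2008, §0 p.12] [cite: MochizukiFrdI2008, Ex. 6.3 p.113].

CONTENTS (ns `Literature.IUT.LogThetaLattice.Prop37.FrakRlfCat`), for the divisor monoid `Φ^rlf(∗) = EffDiv`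
(effective real families at the model places; part C's `PhiRlf F` at the unique object) of the categorical
realified Frobenioid:
* `effDivAddEquiv : Φ^rlf(∗) ≃+ (ModelPlaces F →₀ ℝ_{≥0})` / `effDivMulEquiv` (multiplicative rendering) — the
  realified divisor monoid IS the free `ℝ_{≥0}`-module on the places ("`(Φ^rlf)^gp(L) = ⊕_v ℝ`" of [FrdI]
  Thm. 6.4 (i) at the model of record, where `Γ_v = ℝ` by construction);
* **`primesEquivPlaces : Primes (Φ^rlf(∗)) ≃ ModelPlaces F`** — "`Prime(†𝒞^⊩_lgp) ⥲ V̲`" (with `V̲ ⥲ V_mod ⥲` the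
  places of `F_mod`, [IUTchI] Def. 3.1 (e) — the layer-L5 identification is not re-typed) for the CATEGORICAL
  `†𝒞^⊩_lgp ≅ (†𝓕⊛ℝ_𝔪𝔬𝔡)_α` (one copy, abc-iut-L6-t4's `Prop37.embDiag`), by transport (abc-iut-L1's `Primes.congr`)
  of abc-iut-w4-d013's `FinsuppNNReal.primesEquiv : Prime(ι →₀ ℝ_{≥0}) ≃ ι`; `primesEquivPlaces_delta` (the prime
  of the primary family `δ_v` is `v`);
* `localDeg v : Φ^rlf(∗) →* ℝ_{≥0}` (multiplicative rendering) — the `v`-component `Φ_{𝒞^⊩,v}` / local degree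
  ([IUTchI] Ex. 3.5 (i)), `clsHom v : (Φ^rlf)^gp(∗) = ⊕'_v ℝ →+ ℝ` on the groupification, `localDeg_delta`,
  `eq_of_localDeg_eq` (a real effective family is determined by its local degrees), and the local degree of
  the zero divisor of a morphism `(n, u) : 𝔍₁ → 𝔍₂` of `(†𝓕⊛ℝ_𝔪𝔬𝔡)_α`: `(u + n•𝔍₁ − 𝔍₂)_v` (`localDeg_div`).
The `†ρ_{lgp,v}` themselves compare `Φ_{𝒞^⊩,v}` with the realified divisor monoids of the LOCAL Frobenioids
`†𝓕^⊢_{lgp,v}` (Prop. 3.4 (ii); abc-iut-L5-t2's `InitialThetaData.rho` at the initial Θ-data over `K`, weights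
`[K_v : (F_mod)_v]⁻¹`); that cross-layer normalisation is NOT re-typed here (named residual: the places
dictionary `ModelPlaces F_mod ↔ Val K / V̲` of abc-iut-L5-t2 / abc-iut-w4-d013 `primesLgpEquiv`). No `Prop`-valued
definition; nothing here asserts a disputed claim or takes a side on [IUTchIII] Cor. 3.12; typed ≠ discharged.
-/

noncomputable section

namespace Literature.IUT.LogThetaLattice

namespace Prop37

namespace FrakRlfCat

open CategoryTheory NumberField GlobalFrobenioidModels Literature.AlgebraicGeometry.Frobenioids
open scoped NNReal

variable (F : Type) [Field F] [NumberField F]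

/-! ### `Φ^rlf(∗) = ⊕_v ℝ_{≥0}`: effective real families are finitely supported `ℝ_{≥0}`-valued functions -/

/-- An effective real family as a finitely supported `ℝ_{≥0}`-valued function on the places.
[cite: MochizukiFrdI2008, Ex. 6.3 p.113] -/
def toNNFamily (D : effDiv (ModelPlaces F) (fun _ => ℝ) nonnegModel) : ModelPlaces F →₀ ℝ≥0 :=
  Finsupp.ofSupportFinite (fun v => ⟨(D : ModelFrakObj F).cls v, D.2 v⟩) (by
    refine (D : ModelFrakObj F).finite.subset fun v hv => ?_
    intro h
    exact hv (Subtype.ext h))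

omit [NumberField F] in
/-- The value of `toNNFamily D` at `v` is the class `D_v ≥ 0`. [cite: MochizukiFrdI2008, Ex. 6.3 p.113] -/
@[simp] theorem coe_toNNFamily_apply (D : effDiv (ModelPlaces F) (fun _ => ℝ) nonnegModel) (v : ModelPlaces F) :
    (toNNFamily F D v : ℝ) = (D : ModelFrakObj F).cls v := rfl

/-- A finitely supported `ℝ_{≥0}`-valued function on the places as an effective real family.
[cite: MochizukiFrdI2008, Ex. 6.3 p.113] -/
def ofNNFamily (a : ModelPlaces F →₀ ℝ≥0) : effDiv (ModelPlaces F) (fun _ => ℝ) nonnegModel :=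
  ⟨⟨fun v => (a v : ℝ), a.support.finite_toSet.subset fun v hv => by
      rw [Finset.mem_coe, Finsupp.mem_support_iff]
      intro h
      apply hv
      show ((a v : ℝ≥0) : ℝ) = 0
      rw [h, NNReal.coe_zero]⟩,
    fun v => (a v).2⟩

omit [NumberField F] in
/-- The class of `ofNNFamily a` at `v` is `a v`. [cite: MochizukiFrdI2008, Ex. 6.3 p.113] -/
@[simp] theorem cls_ofNNFamily (a : ModelPlaces F →₀ ℝ≥0) (v : ModelPlaces F) :
    ((ofNNFamily F a : effDiv (ModelPlaces F) (fun _ => ℝ) nonnegModel) : ModelFrakObj F).cls v = a v := rfl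

/-- **`Φ^rlf(∗) ≅ ⊕_{v} ℝ_{≥0}`** (additively): the divisor monoid of the categorical realified Frobenioid
`(†𝓕⊛ℝ_𝔪𝔬𝔡)_α` is the free `ℝ_{≥0}`-module on the places ([FrdI] Thm. 6.4 (i) "`(Φ^rlf)^gp(L) = ⊕_v ℝ`", here by
construction of the model of record, `Γ_v = ℝ`). [cite: MochizukiFrdI2008, Thm. 6.4 (i) p.115] -/
def effDivAddEquiv : effDiv (ModelPlaces F) (fun _ => ℝ) nonnegModel ≃+ (ModelPlaces F →₀ ℝ≥0) where
  toFun := toNNFamily F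
  invFun := ofNNFamily F
  left_inv _ := Subtype.ext (FrakObj.ext_cls (funext fun _ => rfl))
  right_inv _ := Finsupp.ext fun _ => Subtype.ext rfl
  map_add' _ _ := Finsupp.ext fun _ => Subtype.ext rfl

omit [NumberField F] in
/-- `effDivAddEquiv D v = D_v`. [cite: MochizukiFrdI2008, Thm. 6.4 (i) p.115] -/
@[simp] theorem coe_effDivAddEquiv_apply (D : effDiv (ModelPlaces F) (fun _ => ℝ) nonnegModel) (v : ModelPlaces F) :
    (effDivAddEquiv F D v : ℝ) = (D : ModelFrakObj F).cls v := rfl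

/-- **`Φ^rlf(∗) ≅ ⊕_{v} ℝ_{≥0}`** in the multiplicative rendering of the tree's [FrdI] files (`EffDiv = Multiplicative
effDiv`; part C's `PhiRlf F` at the unique object). [cite: MochizukiFrdI2008, Thm. 6.4 (i) p.115] -/
def effDivMulEquiv :
    EffDiv (ModelPlaces F) (fun _ => ℝ) nonnegModel ≃* Multiplicative (ModelPlaces F →₀ ℝ≥0) :=
  AddEquiv.toMultiplicative (effDivAddEquiv F)

omit [NumberField F] in
/-- `effDivMulEquiv` on `ofAdd D` is `ofAdd (effDivAddEquiv D)`. [cite: MochizukiFrdI2008, Thm. 6.4 (i) p.115] -/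
@[simp] theorem effDivMulEquiv_ofAdd (D : effDiv (ModelPlaces F) (fun _ => ℝ) nonnegModel) :
    effDivMulEquiv F (Multiplicative.ofAdd D) = Multiplicative.ofAdd (effDivAddEquiv F D) := rfl

/-! ### `Prime(†𝒞^⊩_lgp) ⥲ V̲`: the primes of `Φ^rlf(∗)` are the places -/

/-- **`Prime(Φ^rlf(∗)) ≃ {places of F}`** — "`Prime(†𝒞^⊩_lgp) ⥲ V̲`" ([IUTchIII] Prop. 3.7 (iv); [IUTchI] Ex. 3.5 (i)
"`Prime(𝒞^⊩_mod) ⥲ V_mod`"; [FrdI] Ex. 6.3 "`Prime(Φ(L)) ≃ V(L)`") for the divisor monoid of the categorical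
realified Frobenioid `(†𝓕⊛ℝ_𝔪𝔬𝔡)_α`: transport of abc-iut-w4-d013's `FinsuppNNReal.primesEquiv` along
`effDivMulEquiv` (abc-iut-L1's `Primes.congr`). [claim: Mochizuki2012, status: disputed] -/
def primesEquivPlaces : Primes (EffDiv (ModelPlaces F) (fun _ => ℝ) nonnegModel) ≃ ModelPlaces F :=
  (Primes.congr (effDivMulEquiv F)).trans FinsuppNNReal.primesEquiv

/-- The primary effective family `δ_v` (class `1` at `v`, `0` elsewhere) — a generator of the prime of `v`.
[cite: MochizukiFrdI2008, §0 p.12] -/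
def delta (v : ModelPlaces F) : effDiv (ModelPlaces F) (fun _ => ℝ) nonnegModel :=
  ofNNFamily F (Finsupp.single v 1)

omit [NumberField F] in
/-- `effDivAddEquiv (δ_v) = single v 1`. [cite: MochizukiFrdI2008, §0 p.12] -/
@[simp] theorem effDivAddEquiv_delta (v : ModelPlaces F) : effDivAddEquiv F (delta F v) = Finsupp.single v 1 :=
  (effDivAddEquiv F).apply_symm_apply _

omit [NumberField F] in
/-- `δ_v` is a PRIMARY element of `Φ^rlf(∗)` ([FrdI] §0). [cite: MochizukiFrdI2008, §0 p.12] -/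
theorem isPrimary_delta (v : ModelPlaces F) :
    IsPrimary (Multiplicative.ofAdd (delta F v) : EffDiv (ModelPlaces F) (fun _ => ℝ) nonnegModel) := by
  rw [← isPrimary_map_iff (effDivMulEquiv F), effDivMulEquiv_ofAdd, effDivAddEquiv_delta]
  exact FinsuppNNReal.isPrimary_single v

omit [NumberField F] in
/-- **The prime of `δ_v` is `v`** under `Prime(Φ^rlf(∗)) ≃ {places}`. [claim: Mochizuki2012, status: disputed] -/
theorem primesEquivPlaces_delta (v : ModelPlaces F) :
    primesEquivPlaces F (Quotient.mk (primarySetoid _) ⟨Multiplicative.ofAdd (delta F v), isPrimary_delta F v⟩) = v := by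
  have key : (⟨effDivMulEquiv F (Multiplicative.ofAdd (delta F v)), (isPrimary_delta F v).map_mulEquiv _⟩ :
        primaries (Multiplicative (ModelPlaces F →₀ ℝ≥0))) =
      ⟨Multiplicative.ofAdd (Finsupp.single v 1), FinsuppNNReal.isPrimary_single v⟩ := by
    apply Subtype.ext
    show effDivMulEquiv F (Multiplicative.ofAdd (delta F v)) = Multiplicative.ofAdd (Finsupp.single v 1)
    rw [effDivMulEquiv_ofAdd, effDivAddEquiv_delta]
  unfold primesEquivPlaces
  rw [Equiv.trans_apply, Primes.congr_mk (effDivMulEquiv F) _ (isPrimary_delta F v) ((isPrimary_delta F v).map_mulEquiv _), key]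
  exact FinsuppNNReal.primesEquiv_mk_single v

omit [NumberField F] in
/-- `Prime(Φ^rlf(∗)) ≃ {places}` is surjective onto the places: every place is the prime of its `δ_v`.
[claim: Mochizuki2012, status: disputed] -/
theorem primesEquivPlaces_symm_apply (v : ModelPlaces F) :
    (primesEquivPlaces F).symm v =
      Quotient.mk (primarySetoid _) ⟨Multiplicative.ofAdd (delta F v), isPrimary_delta F v⟩ :=
  (primesEquivPlaces F).injective (by rw [Equiv.apply_symm_apply, primesEquivPlaces_delta])

/-! ### Local degrees: the `v`-components `Φ^rlf(∗) → Φ^rlf_v = ℝ_{≥0}` and `(Φ^rlf)^gp(∗) → ℝ` -/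

/-- The `v`-component of the groupification `(Φ^rlf)^gp(∗) = ⊕'_v ℝ`: `𝔍 ↦ [𝔍_v] ∈ ℝ`.
[claim: Mochizuki2012, status: disputed] -/
def clsHom (v : ModelPlaces F) : ModelFrakObj F →+ ℝ where
  toFun J := J.cls v
  map_zero' := rfl
  map_add' _ _ := rfl

/-- `clsHom v 𝔍 = 𝔍_v`. [claim: Mochizuki2012, status: disputed] -/
@[simp] theorem clsHom_apply (v : ModelPlaces F) (J : ModelFrakObj F) : clsHom F v J = J.cls v := rfl

/-- **The local degree at `v`**: the `v`-component `Φ^rlf(∗) → Φ_{𝒞^⊩,v} = ℝ_{≥0}` of the divisor monoid of the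
categorical realified Frobenioid ([IUTchI] Ex. 3.5 (i) "the `v`-component of `Φ_{𝒞^⊩_mod}`", the source of
`ρ_v`), multiplicative rendering. [claim: Mochizuki2012, status: disputed] -/
def localDeg (v : ModelPlaces F) :
    EffDiv (ModelPlaces F) (fun _ => ℝ) nonnegModel →* Multiplicative ℝ≥0 :=
  (AddMonoidHom.toMultiplicative (Finsupp.applyAddHom v)).comp (effDivMulEquiv F).toMonoidHom

omit [NumberField F] in
/-- `localDeg v (ofAdd D) = D_v`. [claim: Mochizuki2012, status: disputed] -/
@[simp] theorem coe_toAdd_localDeg (v : ModelPlaces F) (D : effDiv (ModelPlaces F) (fun _ => ℝ) nonnegModel) :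
    ((Multiplicative.toAdd (localDeg F v (Multiplicative.ofAdd D)) : ℝ≥0) : ℝ) = (D : ModelFrakObj F).cls v := rfl

/-- The local degree is the `v`-component read on the groupification: `localDeg v D = clsHom v D`.
[claim: Mochizuki2012, status: disputed] -/
theorem coe_toAdd_localDeg_eq_clsHom (v : ModelPlaces F) (D : effDiv (ModelPlaces F) (fun _ => ℝ) nonnegModel) :
    ((Multiplicative.toAdd (localDeg F v (Multiplicative.ofAdd D)) : ℝ≥0) : ℝ) = clsHom F v (D : ModelFrakObj F) :=
  rfl

omit [NumberField F] in
/-- `localDeg v (δ_v) = 1` and `localDeg w (δ_v) = 0` for `w ≠ v`: `δ_v` is concentrated at its prime.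
[cite: MochizukiFrdI2008, §0 p.12] -/
theorem localDeg_delta (v w : ModelPlaces F) :
    Multiplicative.toAdd (localDeg F w (Multiplicative.ofAdd (delta F v))) = Finsupp.single v (1 : ℝ≥0) w := by
  show effDivAddEquiv F (delta F v) w = _
  rw [effDivAddEquiv_delta]

omit [NumberField F] in
/-- **An effective real family is determined by its local degrees** (`Φ^rlf(∗) ↪ ∏_v ℝ_{≥0}`).
[cite: MochizukiFrdI2008, Thm. 6.4 (i) p.115] -/
theorem eq_of_localDeg_eq {D E : EffDiv (ModelPlaces F) (fun _ => ℝ) nonnegModel}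
    (h : ∀ v, localDeg F v D = localDeg F v E) : D = E := by
  apply (effDivMulEquiv F).injective
  apply Multiplicative.toAdd.injective
  refine Finsupp.ext fun v => ?_
  exact congrArg Multiplicative.toAdd (h v)

/-- The local degree at `v` of the zero divisor `Div(n, u) = u + n•𝔍₁ − 𝔍₂ ∈ Φ^rlf(∗)` of a morphism of
`(†𝓕⊛ℝ_𝔪𝔬𝔡)_α` (part B's `FrakRlfCat.eff_mem`; = part C's `homDiv φ` in the Frobenioid structure):
`u_v + n·[𝔍_{1,v}] − [𝔍_{2,v}] ≥ 0`. [cite: MochizukiFrdI2008, Thm. 5.2 (i) p.100] -/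
theorem localDeg_div {X Y : FrakRlfCat F} (φ : X ⟶ Y) (v : ModelPlaces F) :
    ((Multiplicative.toAdd (localDeg F v
        (Multiplicative.ofAdd ⟨fn φ + (deg φ : ℕ) • X.obj - Y.obj, eff_mem φ⟩)) : ℝ≥0) : ℝ) =
      (fn φ).cls v + (deg φ : ℕ) • X.obj.cls v - Y.obj.cls v := by
  show (fn φ + (deg φ : ℕ) • X.obj - Y.obj).cls v = _
  rw [FrakObj.cls_sub, FrakObj.cls_add, FrakObj.cls_nsmul]

/-- The arithmetic degree of a real family is the weighted sum of its local degrees: abc-iut-L6-d3's `frakDeg`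
reads `Σ_v placeMult(v)·[𝔍_v]` through the divisor dictionary; at the level of this file we record only that the
TOTAL degree factors through the local degrees — two effective families with the same local degrees have the same
degree. [cite: MochizukiFrdI2008, Thm. 6.4 (i) p.115] -/
theorem frakDeg_eq_of_localDeg_eq {D E : EffDiv (ModelPlaces F) (fun _ => ℝ) nonnegModel}
    (h : ∀ v, localDeg F v D = localDeg F v E) :
    frakDeg ((Multiplicative.toAdd D : effDiv (ModelPlaces F) (fun _ => ℝ) nonnegModel) : ModelFrakObj F) =
      frakDeg ((Multiplicative.toAdd E : effDiv (ModelPlaces F) (fun _ => ℝ) nonnegModel) : ModelFrakObj F) := by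
  rw [eq_of_localDeg_eq F h]

end FrakRlfCat

end Prop37

end Literature.IUT.LogThetaLattice

end
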